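import Mathlib
import Summits.Ventures.PercRepro2.ReimerDecreasing

/-!
# Reimer's inequality with the restriction flipped to the target (PercRepro2, mine-1)

`reimer_restrict_bar_flip` (`MINE-1.md` §17.5, "16.1′"): for increasing events `A`, `B`, `C` on the
cube `U`, Reimer's counting inequality restricted to the configurations whose BLUE part lies in
`C` is bounded by the target restricted to the configurations whose RED part lies in `C`:

  `#{S ⊆ U : A □ B at S, U \ S ∈ C} ≤ #{S ⊆ U : S ∈ A, U \ S ∈ B, S ∈ C}`.

With `D := {S : U \ S ∈ C}` decreasing this reads `#{(A □ B) ∩ D} ≤ #{A ∩ B̄ ∩ D̄}` — the mirror of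
`reimer_decreasing` (`#{(A □ B) ∩ D} ≤ #{A ∩ B̄ ∩ D}`); both are Reimer's butterfly for the pairs
`(A ∩ D, B)` resp. `(A, B ∩ D)`.  The same Bollobás–Leader induction proves it: now the part of
`A₀ □ B₀` living on `D₀ \ D₁` is absorbed by the induction hypothesis for `(A₁, B₀)` on the larger
set `D₀`, and the hypothesis for `(A₀, B₁)` is used on `D₁`.

Consequence for Conjecture AC (`MINE-1.md` §14.4): both pieces `ℒ₁ = ((A∩C) □ B) ∩ C̄` (by
`reimer_restrict_bar`) and `ℒ₂ = (A □ (B∩C)) ∩ C̄` (by this theorem) are bounded by the SAME target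
`ℛ = A ∩ B̄ ∩ C ∩ C̄` through elementary arguments; AC is the statement for their union.
-/

namespace Summit.Ventures.PercRepro2

namespace ReimerCube

variable {E : Type*} [DecidableEq E]

open Classical in
/-- **Reimer's inequality with the restriction flipped (MINE-1 16.1′).**  For increasing `A`, `B`,
`C` and a ground set `U`:
`#{S ⊆ U : A □ B at S ∧ C (U \ S)} ≤ #{S ⊆ U : A S ∧ B (U \ S) ∧ C S}`. -/
theorem reimer_restrict_bar_flip (U : Finset E) :
    ∀ (A B C : Finset E → Prop), Incr A → Incr B → Incr C →
      (U.powerset.filter (fun S => DOcc A B S ∧ C (U \ S))).card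
        ≤ (U.powerset.filter (fun S => A S ∧ B (U \ S) ∧ C S)).card := by
  induction U using Finset.induction_on with
  | empty =>
    intro A B C _ _ _
    apply Finset.card_le_card
    intro S hS
    rw [Finset.mem_filter, Finset.mem_powerset] at hS ⊢
    obtain ⟨hS0, ⟨K, L, hK, hL, -, hAK, hBL⟩, hCS⟩ := hS
    have hS0' : S = ∅ := Finset.subset_empty.mp hS0
    subst hS0'
    refine ⟨Finset.Subset.refl _, hAK _ hK, hBL _ (hL.trans (Finset.empty_subset _)), ?_⟩
    simpa using hCS
  | insert i U hi ih =>
    intro A B C hA hB hC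
    rw [card_filter_powerset_insert hi, card_filter_powerset_insert hi]
    -- the four filters on `𝒫(U)` through the sections
    have e0 : U.powerset.filter (fun S => DOcc A B S ∧ C (insert i U \ S))
        = U.powerset.filter (fun S => DOcc A B S ∧ sec1 i C (U \ S)) := by
      apply Finset.filter_congr
      intro S hS
      rw [insert_sdiff_of_not_mem' (Finset.mem_powerset.mp hS) hi]
      rfl
    have e1 : U.powerset.filter (fun S => DOcc A B (insert i S) ∧ C (insert i U \ insert i S))
        = U.powerset.filter
            (fun S => (DOcc A (sec1 i B) S ∨ DOcc (sec1 i A) B S) ∧ C (U \ S)) := by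
      apply Finset.filter_congr
      intro S hS
      rw [dOcc_insert_iff hB (fun h => hi (Finset.mem_powerset.mp hS h)), insert_sdiff_insert' hi]
    have e2 : U.powerset.filter (fun S => A S ∧ B (insert i U \ S) ∧ C S)
        = U.powerset.filter (fun S => A S ∧ sec1 i B (U \ S) ∧ C S) := by
      apply Finset.filter_congr
      intro S hS
      rw [insert_sdiff_of_not_mem' (Finset.mem_powerset.mp hS) hi]
      rfl
    have e3 : U.powerset.filter
          (fun S => A (insert i S) ∧ B (insert i U \ insert i S) ∧ C (insert i S))
        = U.powerset.filter (fun S => sec1 i A S ∧ B (U \ S) ∧ sec1 i C S) := by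
      apply Finset.filter_congr
      intro S _
      rw [insert_sdiff_insert' hi]
      rfl
    rw [e0, e1, e2, e3]
    -- the level-1 restriction `D₁ = {C (U \ S)}` is contained in the level-0 one `D₀ = {C₁ (U \ S)}`
    have hD10 : ∀ S, C (U \ S) → sec1 i C (U \ S) := fun S h => incr_le_sec1 hC i _ h
    -- inclusion–exclusion at level 1 (inside `D₁`)
    have hU : U.powerset.filter
          (fun S => (DOcc A (sec1 i B) S ∨ DOcc (sec1 i A) B S) ∧ C (U \ S))
        = U.powerset.filter (fun S => DOcc A (sec1 i B) S ∧ C (U \ S))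
          ∪ U.powerset.filter (fun S => DOcc (sec1 i A) B S ∧ C (U \ S)) := by
      ext S
      simp only [Finset.mem_filter, Finset.mem_union]
      tauto
    have hI : U.powerset.filter
          (fun S => (DOcc A (sec1 i B) S ∧ DOcc (sec1 i A) B S) ∧ C (U \ S))
        = U.powerset.filter (fun S => DOcc A (sec1 i B) S ∧ C (U \ S))
          ∩ U.powerset.filter (fun S => DOcc (sec1 i A) B S ∧ C (U \ S)) := by
      ext S
      simp only [Finset.mem_filter, Finset.mem_inter]
      tauto
    have h_or := Finset.card_union_add_card_inter
      (U.powerset.filter (fun S => DOcc A (sec1 i B) S ∧ C (U \ S)))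
      (U.powerset.filter (fun S => DOcc (sec1 i A) B S ∧ C (U \ S)))
    rw [← hU, ← hI] at h_or
    -- `A₀ □ B₀ ⊆ A₀ □ B₁ ∩ A₁ □ B₀`, inside `D₁`
    have h_sub : (U.powerset.filter (fun S => DOcc A B S ∧ C (U \ S))).card
        ≤ (U.powerset.filter
            (fun S => (DOcc A (sec1 i B) S ∧ DOcc (sec1 i A) B S) ∧ C (U \ S))).card := by
      apply Finset.card_le_card
      intro S hS
      rw [Finset.mem_filter] at hS ⊢
      exact ⟨hS.1, ⟨hS.2.1.mono_right (incr_le_sec1 hB i), hS.2.1.mono_left (incr_le_sec1 hA i)⟩,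
        hS.2.2⟩
    -- split the level-0 counts along `D₁ ⊆ D₀`
    have hs1 : (U.powerset.filter (fun S => DOcc A B S ∧ sec1 i C (U \ S))).card
        = (U.powerset.filter (fun S => DOcc A B S ∧ C (U \ S))).card
          + (U.powerset.filter (fun S => DOcc A B S ∧ sec1 i C (U \ S) ∧ ¬ C (U \ S))).card := by
      have h := Finset.card_filter_add_card_filter_not
        (s := U.powerset.filter (fun S => DOcc A B S ∧ sec1 i C (U \ S))) (fun S => C (U \ S))
      rw [Finset.filter_filter, Finset.filter_filter] at h
      have f1 : U.powerset.filter (fun S => (DOcc A B S ∧ sec1 i C (U \ S)) ∧ C (U \ S))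
          = U.powerset.filter (fun S => DOcc A B S ∧ C (U \ S)) := by
        apply Finset.filter_congr
        intro S _
        constructor
        · rintro ⟨⟨h1, -⟩, h3⟩
          exact ⟨h1, h3⟩
        · rintro ⟨h1, h3⟩
          exact ⟨⟨h1, hD10 S h3⟩, h3⟩
      have f2 : U.powerset.filter (fun S => (DOcc A B S ∧ sec1 i C (U \ S)) ∧ ¬ C (U \ S))
          = U.powerset.filter (fun S => DOcc A B S ∧ sec1 i C (U \ S) ∧ ¬ C (U \ S)) := by
        apply Finset.filter_congr
        intro S _
        tauto
      rw [f1, f2] at h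
      omega
    have hs2 : (U.powerset.filter (fun S => DOcc (sec1 i A) B S ∧ sec1 i C (U \ S))).card
        = (U.powerset.filter (fun S => DOcc (sec1 i A) B S ∧ C (U \ S))).card
          + (U.powerset.filter
              (fun S => DOcc (sec1 i A) B S ∧ sec1 i C (U \ S) ∧ ¬ C (U \ S))).card := by
      have h := Finset.card_filter_add_card_filter_not
        (s := U.powerset.filter (fun S => DOcc (sec1 i A) B S ∧ sec1 i C (U \ S)))
        (fun S => C (U \ S))
      rw [Finset.filter_filter, Finset.filter_filter] at h
      have f1 : U.powerset.filter
            (fun S => (DOcc (sec1 i A) B S ∧ sec1 i C (U \ S)) ∧ C (U \ S))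
          = U.powerset.filter (fun S => DOcc (sec1 i A) B S ∧ C (U \ S)) := by
        apply Finset.filter_congr
        intro S _
        constructor
        · rintro ⟨⟨h1, -⟩, h3⟩
          exact ⟨h1, h3⟩
        · rintro ⟨h1, h3⟩
          exact ⟨⟨h1, hD10 S h3⟩, h3⟩
      have f2 : U.powerset.filter
            (fun S => (DOcc (sec1 i A) B S ∧ sec1 i C (U \ S)) ∧ ¬ C (U \ S))
          = U.powerset.filter
              (fun S => DOcc (sec1 i A) B S ∧ sec1 i C (U \ S) ∧ ¬ C (U \ S)) := by
        apply Finset.filter_congr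
        intro S _
        tauto
      rw [f1, f2] at h
      omega
    -- on `D₀ \ D₁`: `A₀ □ B₀ ⊆ A₁ □ B₀`
    have h_sub2 : (U.powerset.filter
          (fun S => DOcc A B S ∧ sec1 i C (U \ S) ∧ ¬ C (U \ S))).card
        ≤ (U.powerset.filter
            (fun S => DOcc (sec1 i A) B S ∧ sec1 i C (U \ S) ∧ ¬ C (U \ S))).card := by
      apply Finset.card_le_card
      intro S hS
      rw [Finset.mem_filter] at hS ⊢
      exact ⟨hS.1, hS.2.1.mono_left (incr_le_sec1 hA i), hS.2.2⟩
    -- induction hypotheses: `(A₀, B₁)` on `D₁`, `(A₁, B₀)` on `D₀`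
    have ih1 := ih A (sec1 i B) C hA (incr_sec1 hB i) hC
    have ih2 := ih (sec1 i A) B (sec1 i C) (incr_sec1 hA i) hB (incr_sec1 hC i)
    omega

open Classical in
/-- The decreasing-event form of 16.1′: for increasing `A`, `B` and decreasing `D` (written as
`D S ↔ C (U \ S)` with `C` increasing), `#{(A □ B) ∩ D} ≤ #{A ∩ B̄ ∩ D̄}`.  Spelled out with
`C`: this is `reimer_restrict_bar_flip`; compare `reimer_restrict_bar` (target restricted by
`C (U \ S)` instead of `C S`). -/
theorem reimer_restrict_bar_flip' (U : Finset E) (A B C : Finset E → Prop) (hA : Incr A)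
    (hB : Incr B) (hC : Incr C) :
    (U.powerset.filter (fun S => DOcc A B S ∧ C (U \ S))).card
      ≤ (U.powerset.filter (fun S => A S ∧ B (U \ S) ∧ C S)).card :=
  reimer_restrict_bar_flip U A B C hA hB hC

end ReimerCube

end Summit.Ventures.PercRepro2
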